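import Literature.AlgebraicGeometry.Motives.HodgeTensorMumfordTateGroupTateProofs
import HarnessLib

/-!
# Discharged fact: the Hodge group of the Tate structure `ℚ(j)` is trivial

`Literature.AlgebraicGeometry.Motives.HodgeTensor` records as a named fact
(`Literature.AlgebraicGeometry.Motives.HodgeStructure.hodgeGroup_tate : Prop`) the sanity check that, for
every `j`, the Hodge group of the Tate Hodge structure `ℚ(j)` (weight `-2j`, purely of type `(-j,-j)`),
in the stabiliser form `Literature.AlgebraicGeometry.Motives.HodgeStructure.hodgeGroup` (the subgroup of
`GL(V)` — here its group of `ℚ`-points `V ≃ₗ[ℚ] V` — fixing every rational tensor `t ∈ T^{a,b} V`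
of Hodge type `(p,p)`, `(a - b) n = 2p`, in the tensor spaces `T^{a,b} V = V^{⊗a} ⊗ (V^∨)^{⊗b}`), is
trivial: `(tate j).hodgeGroup = ⊥`.  This is the companion of the tree's
`HodgeStructure.mumfordTateGroup_tate_holds` (`MT(ℚ(j)) = GL₁` for `j ≠ 0`, file
`HodgeTensorMumfordTateGroupTateProofs`) and the last undischarged named fact of `Motives/HodgeTensor`;
with it the restatements `Literature.AlgebraicGeometry.Motives.Hodge.hodgeGroup_tate (h : hodgeGroup_tate)`
and `….mumfordTateGroup_tate_zero (h : hodgeGroup_tate)` (`MT(ℚ(0)) = 1`) of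
`Motives/HodgeStructures` and `Motives/HodgeTensor` can be fed `hodgeGroup_tate_holds`.

Source of the definition: P. Deligne, *Hodge cycles on abelian varieties*, LNM 900, I §3 (held text
`book:deligne1982-hodge-cycles-motives-shimura-varieties`, chunk p0038: the tensor spaces
`T = V^{⊗m₁} ⊗ V^{∨⊗m₂} ⊗ ℚ(1)^{⊗m₃}` with their action of `GL(V) × 𝔾ₘ`, the group `G` fixing the
rational tensors of type `(0,0)`; chunk p0039 L1, Prop. 3.4: «The group G is the smallest algebraic
subgroup of GL(V) × 𝔾ₘ defined over ℚ for which μ(𝔾ₘ) ⊂ G»; chunk p0040 L3: «the special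
Mumford–Tate group of (V,h), G⁰ = Ker(G → 𝔾ₘ)» = the Hodge group).  For `V = ℚ(j) = V^{-j,-j}` the
special Mumford–Tate group is `Ker(x ↦ x) = 1`; in the stabiliser form used by the tree this is the
computation below.

## Proof

For the vendored stabiliser definition the statement is elementary multilinear algebra; of the Hodge
filtration of `ℚ(j)` only `F^{-j} ℚ(j) = ℚ(j)_ℂ` is used, and the standing instance hypothesis
`[HodgeTensorFacts]` of the constructions is only carried, not used.

* `T^{1,0} ℚ(j) = ℚ(j)^{⊗1} ⊗ (ℚ(j)^∨)^{⊗0}` is purely of type `(-j,-j)`: its Hodge filtration has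
  `F^{-j} = ⊤` (`tensorSpace_one_zero_F_eq_top`: the summand `F^{-j}(ℚ^{⊗1}) ⊗ F^{0}((ℚ^∨)^{⊗0})` of
  Deligne's tensor filtration is already everything, because `F^{-j} ℚ(j) = ⊤` and the empty tensor
  power is the unit structure), so EVERY rational tensor in `T^{1,0}` is a Hodge class of type
  `(-j,-j)` (`mem_hodgeClasses_tensorSpace_one_zero`), and `(1 - 0)(-2j) = 2(-j)`.
* Every `g ∈ GL₁(ℚ)` acts on `T^{a,b} ℚ` by the homothety of ratio `(g 1)^a (g⁻¹ 1)^b`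
  (`coe_tensorSpaceAct_rat`, from the sibling file's `linearEquiv_coe_eq_smul_id`,
  `linearEquiv_symm_dualMap_eq_smul_id`, `piTensorProduct_map_smul_id`), i.e. by `g 1` on `T^{1,0}`.
* `T^{1,0} ℚ ≅ ℚ ⊗ ℚ ≅ ℚ` has the non-zero vector `t₀ = (⊗_{Fin 1} 1) ⊗ (⊗_{Fin 0} ·)`
  (`tprod_one_tmul_tprod_elim_ne_zero`, through `PiTensorProduct.subsingletonEquiv`,
  `PiTensorProduct.isEmptyEquiv`, `TensorProduct.lid`).
* Hence `g ∈ Hg(ℚ(j))` fixes `t₀`, `(g 1) • t₀ = t₀`, so `g 1 = 1` and `g = 1`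
  (`hodgeGroup_tate_holds`).

## References

* P. Deligne, *Hodge cycles on abelian varieties* (notes by J. S. Milne), in: Hodge Cycles, Motives,
  and Shimura Varieties, Lecture Notes in Mathematics 900, Springer (1982), 9–100; I §3: the tensor
  spaces `T` and the stabiliser definition of the Mumford–Tate group (paragraph preceding Prop. 3.4),
  Prop. 3.4, and the special Mumford–Tate (Hodge) group `G⁰ = Ker(G → 𝔾ₘ)` (paragraph following
  Principle 3.7's criterion, chunk p0040 L3 of the held text). [Deligne1982HodgeCycles]
* B. Moonen, *An introduction to Mumford–Tate groups*, lecture notes (2004), §4 Key Property 4.5 and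
  §5 (Example: `Hg(ℚ(1)) = 1`) — the source cited by the named fact; not held by the hub, quoted only
  through the fact's docstring. [Moonen2004MT]
-/

open scoped TensorProduct PiTensorProduct

noncomputable section

namespace Literature.AlgebraicGeometry.Motives

universe u v

/-- On the line `V = ℚ`, every `g ∈ GL₁(ℚ) = ℚˣ` acts on the tensor space
`T^{a,b} ℚ = ℚ^{⊗a} ⊗ (ℚ^∨)^{⊗b}` by the homothety of ratio `(g 1)^a · (g⁻¹ 1)^b`: with `c = g 1`,
`d = g⁻¹ 1` one has `g = c • id`, `(g⁻¹)^∨ = d • id` and `g^{⊗a} ⊗ ((g⁻¹)^∨)^{⊗b} = c^a d^b • id`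
(Deligne, LNM 900, I §3: the factorwise action of `GL(V)` on `T = V^{⊗m₁} ⊗ (V^∨)^{⊗m₂}`, here with
`GL(V) = 𝔾ₘ`). [cite: Deligne1982HodgeCycles, I §3 (paragraph preceding Prop. 3.4)] -/
theorem coe_tensorSpaceAct_rat (g : ℚ ≃ₗ[ℚ] ℚ) (a b : ℕ) :
    (tensorSpaceAct (a := a) (b := b) g : hodgeTensorSpace ℚ a b →ₗ[ℚ] hodgeTensorSpace ℚ a b) =
      (g 1 ^ a * g.symm 1 ^ b) • LinearMap.id := by
  rw [coe_tensorSpaceAct, linearEquiv_coe_eq_smul_id, linearEquiv_symm_dualMap_eq_smul_id,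
    piTensorProduct_map_smul_id, piTensorProduct_map_smul_id, TensorProduct.map_smul_left,
    TensorProduct.map_smul_right, TensorProduct.map_id, smul_smul, Fintype.card_fin,
    Fintype.card_fin]

/-- On `T^{1,0} ℚ = ℚ^{⊗1} ⊗ (ℚ^∨)^{⊗0}` an automorphism `g ∈ GL₁(ℚ)` acts by the scalar `g 1`.
[cite: Deligne1982HodgeCycles, I §3 (paragraph preceding Prop. 3.4)] -/
theorem tensorSpaceAct_rat_one_zero (g : ℚ ≃ₗ[ℚ] ℚ) (t : hodgeTensorSpace ℚ 1 0) :
    tensorSpaceAct g t = g 1 • t := by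
  simpa using LinearMap.congr_fun (coe_tensorSpaceAct_rat g 1 0) t

/-- The vector `t₀ = (⊗_{i : Fin 1} 1) ⊗ (⊗_{i : Fin 0} ·) ∈ T^{1,0} ℚ = ℚ^{⊗1} ⊗ (ℚ^∨)^{⊗0}` is
non-zero: under `ℚ^{⊗1} ≅ ℚ` (`PiTensorProduct.subsingletonEquiv`), `(ℚ^∨)^{⊗0} ≅ ℚ`
(`PiTensorProduct.isEmptyEquiv`) and `ℚ ⊗ ℚ ≅ ℚ` (`TensorProduct.lid`) it maps to `1`. [folklore] -/
private theorem tprod_one_tmul_tprod_elim_ne_zero :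
    (PiTensorProduct.tprod ℚ (fun _ : Fin 1 => (1 : ℚ)) ⊗ₜ[ℚ]
        PiTensorProduct.tprod ℚ (fun i : Fin 0 => (Fin.elim0 i : Module.Dual ℚ ℚ)) :
      hodgeTensorSpace ℚ 1 0) ≠ 0 := by
  intro h
  have h' := congrArg (fun x : hodgeTensorSpace ℚ 1 0 =>
    TensorProduct.lid ℚ ℚ (TensorProduct.congr
      (PiTensorProduct.subsingletonEquiv (R := ℚ) (s := fun _ : Fin 1 => ℚ) (0 : Fin 1))
      (PiTensorProduct.isEmptyEquiv (R := ℚ) (Fin 0) (s := fun _ : Fin 0 => Module.Dual ℚ ℚ)) x)) h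
  simp at h'

namespace HodgeStructure

variable {V : Type u} [AddCommGroup V] [Module ℚ V]
variable {W : Type v} [AddCommGroup W] [Module ℚ W]
variable {n m : ℤ}

/-- If `F^t V = V_ℂ`, then `F^p (V^{⊗r}) = (V^{⊗r})_ℂ` for every `p ≤ r t`: already the summand of
Deligne's tensor-power filtration with the constant multi-index `a ≡ t` is everything (the map
`⊗ᵢ F^t V → ⊗ᵢ V_ℂ` is onto, pure tensors spanning), pulled back along `piTensorBaseChange`
(the argument of the tree's `exists_tensorPowerFiltration_eq_top_holds`, with the level made
explicit). [cite: DeligneHodgeII1971, 1.1.12] -/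
theorem tensorPowerFiltration_eq_top_of_F_eq_top (H : HodgeStructure V n) (r : ℕ) {t p : ℤ}
    (ht : H.F t = ⊤) (hp : p ≤ r * t) : H.tensorPowerFiltration r p = ⊤ := by
  refine eq_top_iff.2 (le_trans ?_ (le_iSup₂_of_le (fun _ => t) (by simpa using hp) le_rfl))
  have hrange : LinearMap.range (PiTensorProduct.mapIncl fun _ : Fin r => H.F t) = ⊤ := by
    rw [PiTensorProduct.mapIncl, PiTensorProduct.map_range_eq_span_tprod, eq_top_iff,
      ← PiTensorProduct.span_tprod_eq_top, Submodule.span_le]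
    rintro _ ⟨x, rfl⟩
    exact Submodule.subset_span ⟨fun i => ⟨x i, by simp [ht]⟩, rfl⟩
  rw [hrange, Submodule.comap_top]

/-- If `F^a V = V_ℂ` and `F^b W = W_ℂ`, then `F^p (V ⊗ W) = (V ⊗ W)_ℂ` for every `p ≤ a + b`: the
summand `F^a V ⊗ F^b W` of Deligne's tensor filtration is everything (`TensorProduct.map_surjective`),
pulled back along `tensorBaseChange` (the argument of the tree's `exists_tensorFiltration_eq_top`, with
the level made explicit). [cite: DeligneHodgeII1971, 1.1.12] -/
theorem tensorFiltration_eq_top_of_F_eq_top (H₁ : HodgeStructure V n) (H₂ : HodgeStructure W m)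
    {a b p : ℤ} (ha : H₁.F a = ⊤) (hb : H₂.F b = ⊤) (hp : p ≤ a + b) :
    H₁.tensorFiltration H₂ p = ⊤ := by
  refine eq_top_iff.2 (le_trans ?_ (le_iSup₂_of_le a b (le_iSup_of_le hp le_rfl)))
  have hr : LinearMap.range (TensorProduct.mapIncl (H₁.F a) (H₂.F b)) = ⊤ := by
    rw [LinearMap.range_eq_top]
    apply TensorProduct.map_surjective
    · rw [← LinearMap.range_eq_top, Submodule.range_subtype, ha]
    · rw [← LinearMap.range_eq_top, Submodule.range_subtype, hb]
  rw [hr, Submodule.comap_top]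

/-- The tensor space `T^{1,0} ℚ(j) = ℚ(j)^{⊗1} ⊗ (ℚ(j)^∨)^{⊗0}` of the Tate structure is purely of
type `(-j,-j)`: `F^{-j} T^{1,0} ℚ(j)` is everything (`F^{-j} ℚ(j) = ⊤`, and the empty tensor power
`(ℚ(j)^∨)^{⊗0}` is the unit structure, `F^0 = ⊤`). [cite: DeligneHodgeII1971, 1.1.12 and 2.1.13] -/
theorem tensorSpace_one_zero_F_eq_top [HodgeTensorFacts.{0, 0}] (j : ℤ) :
    ((tate j).tensorSpace 1 0).F (-j) = ⊤ := by
  have h1 : ((tate j).tensorPower 1).F (-j) = ⊤ := by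
    rw [tensorPower_F]
    exact tensorPowerFiltration_eq_top_of_F_eq_top (tate j) 1 (t := -j)
      (by rw [tate_F, pureFiltration_of_le le_rfl]) (by simp)
  have h2 : ((tate j).dual.tensorPower 0).F 0 = ⊤ := by
    obtain ⟨t, ht⟩ := (tate j).dual.exists_F_eq_top
    rw [tensorPower_F]
    exact tensorPowerFiltration_eq_top_of_F_eq_top (tate j).dual 0 ht (by simp)
  rw [HodgeStructure.tensorSpace, cast_F, tensor_F]
  exact tensorFiltration_eq_top_of_F_eq_top _ _ h1 h2 (by simp)

/-- Every rational tensor in `T^{1,0} ℚ(j)` is a Hodge class of type `(-j,-j)` (the space is purely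
of that type, `tensorSpace_one_zero_F_eq_top`). [cite: DeligneHodgeII1971, 2.1.13] -/
theorem mem_hodgeClasses_tensorSpace_one_zero [HodgeTensorFacts.{0, 0}] (j : ℤ)
    (t : hodgeTensorSpace ℚ 1 0) : t ∈ ((tate j).tensorSpace 1 0).hodgeClasses (-j) := by
  rw [mem_hodgeClasses_iff, tensorSpace_one_zero_F_eq_top]
  exact Submodule.mem_top

/-- **Discharge of the named fact `hodgeGroup_tate`**: the Hodge group (`ℚ`-points, stabiliser
form) of the Tate structure `ℚ(j)` is trivial for every `j`.  An element `g ∈ Hg(ℚ(j)) ≤ GL₁(ℚ)`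
fixes every rational tensor of type `(p,p)`; all of `T^{1,0} ℚ(j) ≅ ℚ` consists of Hodge classes of
type `(-j,-j)` (`mem_hodgeClasses_tensorSpace_one_zero`, and `(1 - 0)(-2j) = 2(-j)`), on which `g`
acts by the scalar `g 1` (`tensorSpaceAct_rat_one_zero`); evaluating on the non-zero vector `t₀`
(`tprod_one_tmul_tprod_elim_ne_zero`) gives `g 1 = 1`, i.e. `g = 1`.  In Deligne's language: the
special Mumford–Tate group `G⁰ = Ker(G → 𝔾ₘ)` of `ℚ(j) = ℚ(j)^{-j,-j}` is trivial (LNM 900, I §3);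
Moonen, §5, Example `Hg(ℚ(1)) = 1`.
[cite: Deligne1982HodgeCycles, I §3 (definition preceding Prop. 3.4; G⁰ = Ker(G → 𝔾ₘ))]
[cite: Moonen2004MT, §5] -/
theorem hodgeGroup_tate_holds : hodgeGroup_tate := by
  intro _ j
  refine eq_bot_iff.2 fun g hg => ?_
  rw [Subgroup.mem_bot]
  have hfix : ∀ t : hodgeTensorSpace ℚ 1 0, tensorSpaceAct g t = t := fun t =>
    (mem_hodgeGroup_iff _ g).1 hg 1 0 (-j) (by push_cast; ring) t
      (mem_hodgeClasses_tensorSpace_one_zero j t)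
  have h1 : g 1 = 1 := by
    have h := hfix (PiTensorProduct.tprod ℚ (fun _ : Fin 1 => (1 : ℚ)) ⊗ₜ[ℚ]
      PiTensorProduct.tprod ℚ (fun i : Fin 0 => (Fin.elim0 i : Module.Dual ℚ ℚ)))
    rw [tensorSpaceAct_rat_one_zero] at h
    exact smul_left_injective ℚ tprod_one_tmul_tprod_elim_ne_zero (h.trans (one_smul ℚ _).symm)
  refine LinearEquiv.ext fun x => ?_
  have hx : g x = x * g 1 := by
    simpa [smul_eq_mul] using g.map_smul x (1 : ℚ)
  rw [hx, h1, mul_one]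
  rfl

end HodgeStructure

end Literature.AlgebraicGeometry.Motives

end
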